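import Summits.QuantumFields.BalabanUV.Beta.GAN24.TransportedWordReduction
import Summits.QuantumFields.BalabanUV.Beta.GAN24.VHWordsZeroCell

/-!
# `BalabanUV.Beta.GAN24.CombBorderWordTools` — binder row G-an2-4 ∕ (CONV-C), TRANSFER-III, the (III′) (C)-campaign's supplier `hB0`, TOWARD (27) AT THE COMB DATA (leaf-01 g85
# `README-g85` «LOCATED» (27)_comb: the `E′_c ⊗ VH′_{u′}` word — E-sector on the CELL bond, border on the RESUMMED bond): **THE THREE TRANSPORT-DROPPING LETTERS leaf-04 g66's (27)
# `VHWordsZeroCell` NEEDS AT THE COMB DATA** — (i) the fm COLUMN CHARGES of the sandwich `Ψ̂ K Ψ̂ᵀ` are those of `K` (the right `Ψ̂ᵀ` is the identity on multiplier columns; the left `Ψ̂`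
# reads the `Lc`-periodic face-charge profile, which `Ψ_S` fixes — leaf-01 g84 F5 `corrPsiS_eq_self_of_periodic`); (ii) the FIRST-LEG-weighted bond-resummed current of the dressed vertex
# over `unitS (slotPsiS T)` is that over `unitS T` (twin of A2 §1); (iii) IN THE ZERO MODE the exit-face-read LEFT FAMILY of the vertex over `unitS (slotPsiS W)` pairs with every periodic
# bounded form exactly as that over `unitS W` (cell regrouping `CoarseBondCellPairing` ⨾ (ii))
# (G-an2-4 CRUX TEAM (2), leaf prover `b2b-balaban-gan24-formalise-leaf-01`, gen 86; journal [LEAF01-G86-INTENT-3])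

NOT IN PRINT; OUR BOOKKEEPING ([folklore] BY NAME over d1-leaf-03's `SymCorrectorKernel` (`comp_psiKS_inl`, `comp_trK_psiKS_inr`, `corrPsiS_apply_eq_sum`, `exists_finset_corrReadsS`), leaf-01
g84 F5 `SymCorrectorZeroSymbol.corrPsiS_eq_self_of_periodic`, leaf-04's `VHWordsZeroCell.hasSum_dressedStep_fm_col ∕ hasSum_sgnK_dressedStep_fm_col`, `ExchangeSlotResum.summable_pair_slot`,
`CoarseBondCellPairing.sum_box_tsum_sum_mul_periodic_of_cov`, `VHWordsZeroBorder.unitS_translate_block`, `EEWordReduced.shiftK_dressedStep`, d1-leaf-03's `SymCorrectorFace.slotPsiS_shift`,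
leaf-01 g85 F8 §4 `CombSlotResumTransport.tsum_vertexOfK_dressedStep_slotPsiS`, an2's `vertexOfK_translate_block ∕ vertexFamily_vertexOfK`; 0 `def`, 0 cited fact, 0 `def … : Prop`, 0 sorry).
HONEST FRAMING (cell contract, verbatim): «discharging `BetaPertH` makes Bałaban's UV stability UNCONDITIONAL — a real constructive-QFT result; it is NOT the continuum limit and NOT
the Clay problem.»  HONEST DEPENDENCY (verbatim): «continuum YM on T⁴ ⇐ BetaPertH ∧ nine spine estimates (0/9 proved); BetaPertH ⇐ (D1) ∧ (D4) ∧ CAP+tail; G-an2-4 gates asym, D1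
and NE2/3/4.»

## What is proved (generic `d`)
* §1 (`Ψ̂ = psiKS r n`, `0 < n`, `r ∈ box`) **`hasSum_sandwich_inl_inr_col`**: if `z′ ↦ K y (n•z′) (inl κ)(inr m)` has sums `cK κ m y` with `cK κ m` `n`-periodic in `y`, then
  `z′ ↦ (Ψ̂KΨ̂ᵀ) y₁ (n•z′) (inl a)(inr m)` has sum `cK a m y₁`; instances **`hasSum_sandwich_dressedStep_fm_col`** ∕ **`hasSum_sandwich_sgnK_dressedStep_fm_col`** (the dressed step kernel `X̃♮_j`,
  every `j`, in-block kernel root, transport root ∈ box, all units).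
* §2 (`[NeZero Lc]`, `1 ≤ Lc`, in-block kernel root `toSite rb`, every `j`, any transport root `r′`, any local `T`, `|ρ| ≤ 1`) **`tsum_prod_weight_fst_vertexOfK_dressedStep_slotPsiS`** (product form) and
  **`tsum_tsum_weight_fst_vertexOfK_dressedStep_slotPsiS`** (nested form): `Σ_{(v,y)} ρ(y)·vertexOfK X̃♮_j Lc (unitS (slotPsiS r′ Lc T)) μ v y z f g = Σ_{(v,y)} ρ(y)·vertexOfK X̃♮_j Lc (unitS T) μ v y z f g`.
* §3 the exit-face-read LEFT FAMILY `j^T_u(a, y₁) = Σ'_y 𝟙f(y_γ)·vertexOfK X̃♮_j Lc (unitS T) μ u y y₁ (inl γ)(inl a)` of a generic local table `T`: `abs_leftFamily_le_of_locStencil`,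
  `summable_leftFamily_mul_of_locStencil` (bounded partner), `leftFamily_cov_of_block_cov` (coarse-bond covariance for block-covariant `T`), and **`sum_box_leftFamily_slotPsiS_eq`**:
  `Σ_{c ∈ box Lc} Σ'_{y₁} Σ_a j^{slotPsiS W}_{toSite c}(a,y₁)·A a y₁ = Σ_{c ∈ box Lc} Σ'_{y₁} Σ_a j^{W}_{toSite c}(a,y₁)·A a y₁` for every `Lc`-periodic bounded `A` and every local block-covariant `W`.
WHAT THIS IS NOT: no word is evaluated here ((27)_comb is `CombBorderWordsZero`); NO value; NOT `hB0`; NEVER «G-an2-4 closed» as (CONV-C); NOT D1, NOT `BetaPertH`, NOT continuum, NOT Clay.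
2026-08-27; no existing file touched.
-/

noncomputable section

open Finset
open scoped BigOperators
open Literature.MathematicalPhysics.QuantumFieldTheory
open Literature.MathematicalPhysics.QuantumFieldTheory.Balaban1983to89
open Literature.MathematicalPhysics.QuantumFieldTheory.Balaban1983to89.Beta
open B12Sec2to5 (l1)
open ExpKernelCalculus (Site MKer comp shiftK Decays BiLoc VertexFamily summable_exp_shift')
open AffineAveraging (Form1 box toSite)
open OneStepResolventKernel (Fib LocStencil decays_mono biLoc_mono)
open OneStepKernelFamily (KInvStep vertexOfK vertexFamily_vertexOfK decays_KInvStep)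
open BalabanStepJetsSucc (vertexOfK_translate_block)
open Summit.QuantumFields.BalabanUV.Beta.TameKernelCalculus (trK trK_apply biLoc_trK)
open Summit.QuantumFields.BalabanUV.Beta.BorderedHessian (sgnK)
open Summit.QuantumFields.BalabanUV.Beta.AxialDressingRooted (coDressKBmAt decays_coDressKBmAt)
open Summit.QuantumFields.BalabanUV.Beta.HessKerDressedUnits (unitK unitS decays_unitK locStencil_unitS)
open Summit.QuantumFields.BalabanUV.Beta.CompositeCorrectorKernel (indR)
open Summit.QuantumFields.BalabanUV.Beta.SymCorrectorForms (corrPsiS)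
open Summit.QuantumFields.BalabanUV.Beta.SymCorrectorKernel (psiKS comp_psiKS_inl comp_trK_psiKS_inr corrPsiS_apply_eq_sum exists_finset_corrReadsS)
open Summit.QuantumFields.BalabanUV.Beta.SymCorrectorFace (slotPsiS slotPsiS_shift)
open Summit.QuantumFields.BalabanUV.Beta.SymCorrectorSockets (locStencil_slotPsiS)
open Summit.QuantumFields.BalabanUV.Beta.GAN24.SymCorrectorZeroSymbol (corrPsiS_eq_self_of_periodic)
open Summit.QuantumFields.BalabanUV.Beta.GAN24.CombTransportedBorder (slotPsiS_unitS)
open Summit.QuantumFields.BalabanUV.Beta.GAN24.CombSlotResumTransport (tsum_vertexOfK_dressedStep_slotPsiS tsum_prod_swap)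
open Summit.QuantumFields.BalabanUV.Beta.GAN24.ExchangeSlotResum (summable_pair_slot face_weight_periodic)
open Summit.QuantumFields.BalabanUV.Beta.GAN24.VHWordsZeroCell (hasSum_dressedStep_fm_col hasSum_sgnK_dressedStep_fm_col)
open Summit.QuantumFields.BalabanUV.Beta.GAN24.VHWordsZeroBorder (unitS_translate_block)
open Summit.QuantumFields.BalabanUV.Beta.GAN24.EEWordReduced (shiftK_dressedStep)
open Summit.QuantumFields.BalabanUV.Beta.GAN24.CoarseBondCellPairing (sum_box_tsum_sum_mul_periodic_of_cov)

namespace Summit.QuantumFields.BalabanUV.Beta.GAN24.CombBorderWordTools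

variable {d : ℕ}

/-! ## §1 The fm column charges of the sandwich `Ψ̂ K Ψ̂ᵀ` are those of `K` -/

section Sandwich

variable {n : ℕ} (hn : 0 < n) {r : Fin (d + 1) → ℕ} (hr : r ∈ box (d + 1) n)
include hn hr

/-- NOT IN PRINT; OUR BOOKKEEPING ([folklore]).  **THE `(inl, inr)` COARSE COLUMN CHARGES OF `Ψ̂ K Ψ̂ᵀ` ARE THOSE OF `K`** whenever the latter, `cK κ m y = Σ_{z′} K y (n•z′) (inl κ)(inr m)`, are
`n`-periodic in `y`: the right `Ψ̂ᵀ` is the identity on a multiplier column (`comp_trK_psiKS_inr`); the left `Ψ̂` acts on the column as `Ψ_S` (`comp_psiKS_inl`), a FINITE combination of its reads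
(`corrPsiS_apply_eq_sum`) — so the `z′`-sums pass inside — and `Ψ_S` fixes the periodic profile `cK · m` (`corrPsiS_eq_self_of_periodic`). -/
theorem hasSum_sandwich_inl_inr_col {K : MKer (d + 1) (Fib d)} {cK : Fin (d + 1) → Fin (d + 1) → Site (d + 1) → ℝ}
    (hK : ∀ (y : Site (d + 1)) (κ m : Fin (d + 1)), HasSum (fun z' : Site (d + 1) => K y ((n : ℤ) • z') (Sum.inl κ) (Sum.inr m)) (cK κ m y))
    (hcK : ∀ (κ m : Fin (d + 1)) (y t : Site (d + 1)), cK κ m (y + (n : ℤ) • t) = cK κ m y) (y₁ : Site (d + 1)) (a m : Fin (d + 1)) :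
    HasSum (fun z' : Site (d + 1) => comp (comp (psiKS r n) K) (trK (psiKS r n)) y₁ ((n : ℤ) • z') (Sum.inl a) (Sum.inr m)) (cK a m y₁) := by
  classical
  obtain ⟨S, hS⟩ := exists_finset_corrReadsS (d := d) hn a y₁
  have e : ∀ z : Site (d + 1), comp (comp (psiKS r n) K) (trK (psiKS r n)) y₁ z (Sum.inl a) (Sum.inr m)
      = ∑ p ∈ S, corrPsiS (toSite r) n (indR p.1 p.2) a y₁ * K p.2 z (Sum.inl p.1) (Sum.inr m) := by
    intro z
    rw [comp_trK_psiKS_inr (comp (psiKS r n) K) y₁ z (Sum.inl a) m, comp_psiKS_inl hn hr K y₁ z a (Sum.inr m)]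
    exact corrPsiS_apply_eq_sum hn hr a y₁ hS _
  simp only [e]
  have hv : ∑ p ∈ S, corrPsiS (toSite r) n (indR p.1 p.2) a y₁ * cK p.1 m p.2 = cK a m y₁ := by
    rw [← corrPsiS_apply_eq_sum hn hr a y₁ hS (fun κ y => cK κ m y), corrPsiS_eq_self_of_periodic (n := n) (toSite r) (fun κ x t => hcK κ m x t)]
  rw [← hv]
  exact hasSum_sum fun p _ => (hK p.2 p.1 m).mul_left _

/-- NOT IN PRINT; OUR BOOKKEEPING ([folklore]).  **THE fm COLUMN CHARGE OF THE SANDWICHED DRESSED STEP KERNEL `Ψ̂ X̃♮_j Ψ̂ᵀ` IS THAT OF `X̃♮_j`** (in-block kernel root `toSite rb`, transport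
period `n = Lc`, every `j`, all units; leaf-04's `VHWordsZeroCell.hasSum_dressedStep_fm_col`: the face-charge profile `[y_κ % Lc = Lc−1]·Lc·(s_m s_f)·δ_{κm}·σ_j` is `Lc`-periodic). -/
theorem hasSum_sandwich_dressedStep_fm_col [NeZero n] {rb : Fin (d + 1) → ℕ} (hLc : 1 ≤ n) (hrb : rb ∈ box (d + 1) n) (sf sm : ℝ) (j : ℕ) (y₁ : Site (d + 1)) (a m : Fin (d + 1)) :
    HasSum (fun z' : Site (d + 1) => comp (comp (psiKS r n) (unitK sf sm (coDressKBmAt (toSite rb) n (KInvStep (d := d) n j)))) (trK (psiKS r n)) y₁ ((n : ℤ) • z') (Sum.inl a) (Sum.inr m))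
      (if y₁ a % (n : ℤ) = (n : ℤ) - 1 then ((n : ℝ) * (sm * sf)) * (if a = m then ((((n ^ (j + 1) : ℕ) : ℝ)) ^ (d + 1 + 1))⁻¹ else 0) else 0) :=
  hasSum_sandwich_inl_inr_col hn hr
    (cK := fun κ m y => if y κ % (n : ℤ) = (n : ℤ) - 1 then ((n : ℝ) * (sm * sf)) * (if κ = m then ((((n ^ (j + 1) : ℕ) : ℝ)) ^ (d + 1 + 1))⁻¹ else 0) else 0)
    (fun y κ m => hasSum_dressedStep_fm_col hLc hrb sf sm j y κ m) (fun κ m y t => by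
      simp only [Pi.add_apply, Pi.smul_apply, smul_eq_mul, Int.add_mul_emod_self_left]) y₁ a m

/-- NOT IN PRINT; OUR BOOKKEEPING ([folklore]).  … and that of `Ψ̂ (sgnK X̃♮_j) Ψ̂ᵀ` is its negative (`VHWordsZeroCell.hasSum_sgnK_dressedStep_fm_col`). -/
theorem hasSum_sandwich_sgnK_dressedStep_fm_col [NeZero n] {rb : Fin (d + 1) → ℕ} (hLc : 1 ≤ n) (hrb : rb ∈ box (d + 1) n) (sf sm : ℝ) (j : ℕ) (y₁ : Site (d + 1)) (a m : Fin (d + 1)) :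
    HasSum (fun z' : Site (d + 1) => comp (comp (psiKS r n) (sgnK (unitK sf sm (coDressKBmAt (toSite rb) n (KInvStep (d := d) n j))))) (trK (psiKS r n)) y₁ ((n : ℤ) • z')
        (Sum.inl a) (Sum.inr m))
      (-(if y₁ a % (n : ℤ) = (n : ℤ) - 1 then ((n : ℝ) * (sm * sf)) * (if a = m then ((((n ^ (j + 1) : ℕ) : ℝ)) ^ (d + 1 + 1))⁻¹ else 0) else 0)) :=
  hasSum_sandwich_inl_inr_col hn hr
    (cK := fun κ m y => -(if y κ % (n : ℤ) = (n : ℤ) - 1 then ((n : ℝ) * (sm * sf)) * (if κ = m then ((((n ^ (j + 1) : ℕ) : ℝ)) ^ (d + 1 + 1))⁻¹ else 0) else 0))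
    (fun y κ m => hasSum_sgnK_dressedStep_fm_col hLc hrb sf sm j y κ m) (fun κ m y t => by
      simp only [Pi.add_apply, Pi.smul_apply, smul_eq_mul, Int.add_mul_emod_self_left]) y₁ a m

end Sandwich

/-! ## §2 The first-leg-weighted bond-resummed current does not see the slot transport -/

section Current

variable {Lc : ℕ} [NeZero Lc] {rb : Fin (d + 1) → ℕ}

/-- NOT IN PRINT; OUR BOOKKEEPING ([folklore]; twin of A2 `TransportedWordReduction.tsum_prod_weight_vertexOfK_dressedStep_slotPsiS` with the weight on the FIRST leg).  For `|ρ| ≤ 1`, any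
transport root `r′`, any local `T`, every second leg `(z, g)` and first-leg type `f`:
`Σ'_{(v,y)} ρ(y)·vertexOfK X̃♮_j Lc (unitS (slotPsiS r′ Lc T)) μ v y z f g = Σ'_{(v,y)} ρ(y)·vertexOfK X̃♮_j Lc (unitS T) μ v y z f g` (pair summability through the transposed vertex families). -/
theorem tsum_prod_weight_fst_vertexOfK_dressedStep_slotPsiS (hLc : 1 ≤ Lc) (hrb : rb ∈ box (d + 1) Lc) (sf sm : ℝ) (j : ℕ) (μ : Fin (d + 1)) (r' : Fin (d + 1) → ℕ)
    {T : Fin (d + 1) → Site (d + 1) → MKer (d + 1) (Fib d)} {CT δT : ℝ} (hT : LocStencil T CT δT) (hδT : 0 < δT)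
    {ρ : Site (d + 1) → ℝ} (hρ : ∀ y, |ρ y| ≤ 1) (z : Site (d + 1)) (f g : Fib d) :
    ∑' vy : Site (d + 1) × Site (d + 1), ρ vy.2 * vertexOfK (unitK sf sm (coDressKBmAt (toSite rb) Lc (KInvStep (d := d) Lc j))) Lc (unitS sf sm (slotPsiS r' Lc T)) μ vy.1 vy.2 z f g
      = ∑' vy : Site (d + 1) × Site (d + 1), ρ vy.2 * vertexOfK (unitK sf sm (coDressKBmAt (toSite rb) Lc (KInvStep (d := d) Lc j))) Lc (unitS sf sm T) μ vy.1 vy.2 z f g := by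
  classical
  have hLc0 : 0 < Lc := hLc
  set X := unitK sf sm (coDressKBmAt (toSite rb) Lc (KInvStep (d := d) Lc j)) with hX
  obtain ⟨δK, CK, hδK, hCK, hXd⟩ := decays_coDressKBmAt hLc hrb (decays_KInvStep (d := d) (Lc := Lc) j)
  have hXu : Decays X (max |sf| |sm| * CK * max |sf| |sm|) δK := decays_unitK (sf := sf) (sm := sm) hXd
  have hCX : 0 ≤ max |sf| |sm| * CK * max |sf| |sm| := by positivity
  have hCT : 0 ≤ CT := (hT 0 0).nonneg (Sum.inl 0)
  set m : ℝ := min δK δT with hm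
  have hm0 : 0 < m := lt_min hδK hδT
  have hX1 : Decays X (max |sf| |sm| * CK * max |sf| |sm|) m := decays_mono hXu hCX le_rfl (min_le_left _ _)
  have hT1 : LocStencil T CT m := fun κ u => biLoc_mono (hT κ u) hCT (min_le_right _ _)
  have hTu := locStencil_unitS (sf := sf) (sm := sm) hT1
  have hTs := locStencil_slotPsiS (d := d) hLc0 r' hTu hm0.le
  have hV := vertexFamily_vertexOfK (N := Lc) hX1 hCX hTu hm0 le_rfl
  have hVs := vertexFamily_vertexOfK (N := Lc) hX1 hCX hTs hm0 le_rfl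
  rw [← slotPsiS_unitS r' Lc sf sm T]
  -- pair summability through the transposed families (the weight sits on their second leg)
  have hs1 := summable_pair_slot (N := Lc) (fun v => trK (vertexOfK X Lc (slotPsiS r' Lc (unitS sf sm T)) μ v)) (half_pos hm0) (fun v => biLoc_trK (hVs μ v)) hρ z g f
  have hs2 := summable_pair_slot (N := Lc) (fun v => trK (vertexOfK X Lc (unitS sf sm T) μ v)) (half_pos hm0) (fun v => biLoc_trK (hV μ v)) hρ z g f
  simp only [trK_apply] at hs1 hs2
  have hs1' : Summable fun yv : Site (d + 1) × Site (d + 1) => ρ yv.1 * vertexOfK X Lc (slotPsiS r' Lc (unitS sf sm T)) μ yv.2 yv.1 z f g :=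
    (hs1.comp_injective (Equiv.prodComm (Site (d + 1)) (Site (d + 1))).injective).congr fun yv => rfl
  have hs2' : Summable fun yv : Site (d + 1) × Site (d + 1) => ρ yv.1 * vertexOfK X Lc (unitS sf sm T) μ yv.2 yv.1 z f g :=
    (hs2.comp_injective (Equiv.prodComm (Site (d + 1)) (Site (d + 1))).injective).congr fun yv => rfl
  rw [tsum_prod_swap (fun v y => ρ y * vertexOfK X Lc (slotPsiS r' Lc (unitS sf sm T)) μ v y z f g),
    tsum_prod_swap (fun v y => ρ y * vertexOfK X Lc (unitS sf sm T) μ v y z f g), hs1'.tsum_prod, hs2'.tsum_prod]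
  refine tsum_congr fun y => ?_
  dsimp only
  rw [tsum_mul_left, tsum_mul_left, hX, tsum_vertexOfK_dressedStep_slotPsiS hLc hrb sf sm j μ r' hTu hm0 y z f g]

/-- NOT IN PRINT; OUR BOOKKEEPING ([folklore]; nested form).  `Σ'_v Σ'_y ρ(y)·vertexOfK X̃♮_j Lc (unitS (slotPsiS r′ Lc T)) μ v y z f g = Σ'_v Σ'_y ρ(y)·vertexOfK X̃♮_j Lc (unitS T) μ v y z f g`. -/
theorem tsum_tsum_weight_fst_vertexOfK_dressedStep_slotPsiS (hLc : 1 ≤ Lc) (hrb : rb ∈ box (d + 1) Lc) (sf sm : ℝ) (j : ℕ) (μ : Fin (d + 1)) (r' : Fin (d + 1) → ℕ)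
    {T : Fin (d + 1) → Site (d + 1) → MKer (d + 1) (Fib d)} {CT δT : ℝ} (hT : LocStencil T CT δT) (hδT : 0 < δT)
    {ρ : Site (d + 1) → ℝ} (hρ : ∀ y, |ρ y| ≤ 1) (z : Site (d + 1)) (f g : Fib d) :
    ∑' v : Site (d + 1), ∑' y : Site (d + 1), ρ y * vertexOfK (unitK sf sm (coDressKBmAt (toSite rb) Lc (KInvStep (d := d) Lc j))) Lc (unitS sf sm (slotPsiS r' Lc T)) μ v y z f g
      = ∑' v : Site (d + 1), ∑' y : Site (d + 1), ρ y * vertexOfK (unitK sf sm (coDressKBmAt (toSite rb) Lc (KInvStep (d := d) Lc j))) Lc (unitS sf sm T) μ v y z f g := by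
  classical
  have hLc0 : 0 < Lc := hLc
  set X := unitK sf sm (coDressKBmAt (toSite rb) Lc (KInvStep (d := d) Lc j)) with hX
  obtain ⟨δK, CK, hδK, hCK, hXd⟩ := decays_coDressKBmAt hLc hrb (decays_KInvStep (d := d) (Lc := Lc) j)
  have hXu : Decays X (max |sf| |sm| * CK * max |sf| |sm|) δK := decays_unitK (sf := sf) (sm := sm) hXd
  have hCX : 0 ≤ max |sf| |sm| * CK * max |sf| |sm| := by positivity
  have hCT : 0 ≤ CT := (hT 0 0).nonneg (Sum.inl 0)
  set m : ℝ := min δK δT with hm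
  have hm0 : 0 < m := lt_min hδK hδT
  have hX1 : Decays X (max |sf| |sm| * CK * max |sf| |sm|) m := decays_mono hXu hCX le_rfl (min_le_left _ _)
  have hT1 : LocStencil T CT m := fun κ u => biLoc_mono (hT κ u) hCT (min_le_right _ _)
  have hTu := locStencil_unitS (sf := sf) (sm := sm) hT1
  have hTs := locStencil_slotPsiS (d := d) hLc0 r' hTu hm0.le
  have hV := vertexFamily_vertexOfK (N := Lc) hX1 hCX hTu hm0 le_rfl
  have hVs := vertexFamily_vertexOfK (N := Lc) hX1 hCX hTs hm0 le_rfl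
  rw [slotPsiS_unitS r' Lc sf sm T] at hVs
  have hs1 := summable_pair_slot (N := Lc) (fun v => trK (vertexOfK X Lc (unitS sf sm (slotPsiS r' Lc T)) μ v)) (half_pos hm0) (fun v => biLoc_trK (hVs μ v)) hρ z g f
  have hs2 := summable_pair_slot (N := Lc) (fun v => trK (vertexOfK X Lc (unitS sf sm T) μ v)) (half_pos hm0) (fun v => biLoc_trK (hV μ v)) hρ z g f
  simp only [trK_apply] at hs1 hs2
  have e1 := hs1.tsum_prod
  have e2 := hs2.tsum_prod
  dsimp only at e1 e2
  rw [← e1, ← e2, hX]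
  exact tsum_prod_weight_fst_vertexOfK_dressedStep_slotPsiS hLc hrb sf sm j μ r' hT hδT hρ z f g

end Current

/-! ## §3 The exit-face-read left family of a generic local table, and its zero-mode blindness to the slot transport -/

section LeftFamily

variable {Lc : ℕ} [NeZero Lc] {rb : Fin (d + 1) → ℕ} {μ γ : Fin (d + 1)} {T : Fin (d + 1) → Site (d + 1) → MKer (d + 1) (Fib d)} {CT δT : ℝ}

/-- [folklore] **THE LEFT FAMILY OF A LOCAL TABLE DECAYS OFF ITS SOURCE**: `|Σ'_y 𝟙f(y_γ)·vertexOfK X̃♮_j Lc (unitS T) μ u y y₁ (inl γ)(inl a)| ≤ (C_v·Σ'_y e^{−δ_v|y − Lc•u|})·e^{−δ_v|y₁ − Lc•u|}`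
(leaf-04's `EEWordReduced.abs_leftFamily_le` with the Wilson table replaced by any local `T`). -/
theorem abs_leftFamily_le_of_locStencil (hLc : 1 ≤ Lc) (hrb : rb ∈ box (d + 1) Lc) (sf sm : ℝ) (j : ℕ) (hT : LocStencil T CT δT) (hδT : 0 < δT) :
    ∃ Cv δv : ℝ, 0 < δv ∧ 0 ≤ Cv ∧ ∀ (u : Site (d + 1)) (a : Fin (d + 1)) (y₁ : Site (d + 1)),
      |∑' y : Site (d + 1), (if y γ % (Lc : ℤ) = (Lc : ℤ) - 1 then (1 : ℝ) else 0) *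
          vertexOfK (unitK sf sm (coDressKBmAt (toSite rb) Lc (KInvStep (d := d) Lc j))) Lc (unitS sf sm T) μ u y y₁ (Sum.inl γ) (Sum.inl a)| ≤
        (Cv * ∑' y : Site (d + 1), Real.exp (-δv * l1 (y - (Lc : ℤ) • u))) * Real.exp (-δv * l1 (y₁ - (Lc : ℤ) • u)) := by
  obtain ⟨δK, CK, hδK, hCK, hXd⟩ := decays_coDressKBmAt hLc hrb (decays_KInvStep (d := d) (Lc := Lc) j)
  have hXu := decays_unitK (sf := sf) (sm := sm) hXd
  have hC : 0 ≤ max |sf| |sm| * CK * max |sf| |sm| := by positivity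
  have hCT : 0 ≤ CT := (hT 0 0).nonneg (Sum.inl 0)
  set m : ℝ := min δK δT with hm
  have hm0 : 0 < m := lt_min hδK hδT
  have hX1 := decays_mono hXu hC le_rfl (min_le_left δK δT)
  have hT1 : LocStencil T CT m := fun κ u => biLoc_mono (hT κ u) hCT (min_le_right _ _)
  have hVF := vertexFamily_vertexOfK (N := Lc) hX1 hC (locStencil_unitS (sf := sf) (sm := sm) hT1) hm0 le_rfl
  set V := vertexOfK (unitK sf sm (coDressKBmAt (toSite rb) Lc (KInvStep (d := d) Lc j))) Lc (unitS sf sm T) with hVdef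
  set Cv : ℝ := ((d + 1 : ℕ) : ℝ) * (max |sf| |sm| * CK * max |sf| |sm| * (|(sf * sm)⁻¹| * (max |sf⁻¹| |sm⁻¹| * CT * max |sf⁻¹| |sm⁻¹|)) * ExpKernelCalculus.Zl (d + 1) (m / 2))
    with hCvdef
  have hCv0 : 0 ≤ Cv := (hVF μ 0).nonneg (Sum.inl 0)
  refine ⟨Cv, m / 2, half_pos hm0, hCv0, fun u a y₁ => ?_⟩
  have hpt : ∀ y : Site (d + 1), |(if y γ % (Lc : ℤ) = (Lc : ℤ) - 1 then (1 : ℝ) else 0) * V μ u y y₁ (Sum.inl γ) (Sum.inl a)| ≤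
      Cv * Real.exp (-(m / 2) * l1 (y - (Lc : ℤ) • u)) * Real.exp (-(m / 2) * l1 (y₁ - (Lc : ℤ) • u)) := by
    intro y
    rw [abs_mul]
    have h1 : |(if y γ % (Lc : ℤ) = (Lc : ℤ) - 1 then (1 : ℝ) else 0)| ≤ 1 := by split_ifs <;> simp
    have h2 := hVF μ u y y₁ (Sum.inl γ) (Sum.inl a)
    rw [mul_add, Real.exp_add, ← mul_assoc] at h2
    calc |(if y γ % (Lc : ℤ) = (Lc : ℤ) - 1 then (1 : ℝ) else 0)| * |V μ u y y₁ (Sum.inl γ) (Sum.inl a)|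
        ≤ 1 * (Cv * Real.exp (-(m / 2) * l1 (y - (Lc : ℤ) • u)) * Real.exp (-(m / 2) * l1 (y₁ - (Lc : ℤ) • u))) := mul_le_mul h1 h2 (abs_nonneg _) zero_le_one
      _ = _ := one_mul _
  have hZ : Summable fun y : Site (d + 1) => Real.exp (-(m / 2) * l1 (y - (Lc : ℤ) • u)) := summable_exp_shift' (half_pos hm0) ((Lc : ℤ) • u)
  have hmaj : Summable fun y : Site (d + 1) => Cv * Real.exp (-(m / 2) * l1 (y - (Lc : ℤ) • u)) * Real.exp (-(m / 2) * l1 (y₁ - (Lc : ℤ) • u)) := (hZ.mul_left Cv).mul_right _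
  have hsy : Summable fun y : Site (d + 1) => ‖(if y γ % (Lc : ℤ) = (Lc : ℤ) - 1 then (1 : ℝ) else 0) * V μ u y y₁ (Sum.inl γ) (Sum.inl a)‖ :=
    Summable.of_nonneg_of_le (fun _ => norm_nonneg _) (fun y => by rw [Real.norm_eq_abs]; exact hpt y) hmaj
  calc |∑' y : Site (d + 1), (if y γ % (Lc : ℤ) = (Lc : ℤ) - 1 then (1 : ℝ) else 0) * V μ u y y₁ (Sum.inl γ) (Sum.inl a)|
      ≤ ∑' y : Site (d + 1), ‖(if y γ % (Lc : ℤ) = (Lc : ℤ) - 1 then (1 : ℝ) else 0) * V μ u y y₁ (Sum.inl γ) (Sum.inl a)‖ := by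
        rw [← Real.norm_eq_abs]; exact norm_tsum_le_tsum_norm hsy
    _ ≤ ∑' y : Site (d + 1), Cv * Real.exp (-(m / 2) * l1 (y - (Lc : ℤ) • u)) * Real.exp (-(m / 2) * l1 (y₁ - (Lc : ℤ) • u)) :=
        Summable.tsum_le_tsum (fun y => by rw [Real.norm_eq_abs]; exact hpt y) hsy hmaj
    _ = (Cv * ∑' y : Site (d + 1), Real.exp (-(m / 2) * l1 (y - (Lc : ℤ) • u))) * Real.exp (-(m / 2) * l1 (y₁ - (Lc : ℤ) • u)) := by
        rw [tsum_mul_right, tsum_mul_left]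

/-- [folklore] **THE LEFT FAMILY OF A LOCAL TABLE IS SUMMABLE AGAINST ANY BOUNDED FORM** (in its second leg). -/
theorem summable_leftFamily_mul_of_locStencil (hLc : 1 ≤ Lc) (hrb : rb ∈ box (d + 1) Lc) (sf sm : ℝ) (j : ℕ) (hT : LocStencil T CT δT) (hδT : 0 < δT)
    {B : Site (d + 1) → ℝ} {M : ℝ} (hB : ∀ y, |B y| ≤ M) (u : Site (d + 1)) (a : Fin (d + 1)) :
    Summable fun y₁ : Site (d + 1) => (∑' y : Site (d + 1), (if y γ % (Lc : ℤ) = (Lc : ℤ) - 1 then (1 : ℝ) else 0) *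
        vertexOfK (unitK sf sm (coDressKBmAt (toSite rb) Lc (KInvStep (d := d) Lc j))) Lc (unitS sf sm T) μ u y y₁ (Sum.inl γ) (Sum.inl a)) * B y₁ := by
  obtain ⟨Cv, δv, hδv, hCv, hle⟩ := abs_leftFamily_le_of_locStencil (μ := μ) (γ := γ) hLc hrb sf sm j hT hδT
  have hM : 0 ≤ M := (abs_nonneg _).trans (hB 0)
  have hZ0 : 0 ≤ ∑' y : Site (d + 1), Real.exp (-δv * l1 (y - (Lc : ℤ) • u)) := tsum_nonneg fun _ => (Real.exp_pos _).le
  refine Summable.of_norm_bounded ((((summable_exp_shift' hδv ((Lc : ℤ) • u)).mul_left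
    (Cv * ∑' y : Site (d + 1), Real.exp (-δv * l1 (y - (Lc : ℤ) • u)))).mul_right M)) (fun y₁ => ?_)
  rw [Real.norm_eq_abs, abs_mul]
  exact mul_le_mul (hle u a y₁) (hB y₁) (abs_nonneg _) (by positivity)

/-- [folklore] **THE LEFT FAMILY OF A BLOCK-COVARIANT TABLE IS COARSE-BOND COVARIANT**: `j_{u+t}(a, y₁ + Lc•t) = j_u(a, y₁)` (`vertexOfK_translate_block`, then the reindexing `y ↦ y − Lc•t`
under which the face weight is invariant; leaf-04's `EEWordReduced.leftFamily_cov` for any block-covariant `T`). -/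
theorem leftFamily_cov_of_block_cov (hLc : 1 ≤ Lc) (sf sm : ℝ) (j : ℕ) (hTt : ∀ (κ : Fin (d + 1)) (u t : Site (d + 1)), T κ (u + (Lc : ℤ) • t) = shiftK (-((Lc : ℤ) • t)) (T κ u))
    (u : Site (d + 1)) (a : Fin (d + 1)) (y₁ t : Site (d + 1)) :
    ∑' y : Site (d + 1), (if y γ % (Lc : ℤ) = (Lc : ℤ) - 1 then (1 : ℝ) else 0) *
        vertexOfK (unitK sf sm (coDressKBmAt (toSite rb) Lc (KInvStep (d := d) Lc j))) Lc (unitS sf sm T) μ (u + t) y (y₁ + (Lc : ℤ) • t) (Sum.inl γ) (Sum.inl a) =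
      ∑' y : Site (d + 1), (if y γ % (Lc : ℤ) = (Lc : ℤ) - 1 then (1 : ℝ) else 0) *
        vertexOfK (unitK sf sm (coDressKBmAt (toSite rb) Lc (KInvStep (d := d) Lc j))) Lc (unitS sf sm T) μ u y y₁ (Sum.inl γ) (Sum.inl a) := by
  have hV := vertexOfK_translate_block (N := Lc) (fun t => shiftK_dressedStep (r := rb) hLc sf sm j t) (unitS_translate_block (Lc := Lc) sf sm hTt) μ u t
  simp only [hV, shiftK, add_neg_cancel_right]
  have hf : ∀ y : Site (d + 1), (if (y + -((Lc : ℤ) • t)) γ % (Lc : ℤ) = (Lc : ℤ) - 1 then (1 : ℝ) else 0) = (if y γ % (Lc : ℤ) = (Lc : ℤ) - 1 then (1 : ℝ) else 0) := by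
    intro y
    have e : (y + -((Lc : ℤ) • t)) γ % (Lc : ℤ) = y γ % (Lc : ℤ) := by
      simp only [Pi.add_apply, Pi.neg_apply, Pi.smul_apply, smul_eq_mul]
      rw [show y γ + -((Lc : ℤ) * t γ) = y γ + (Lc : ℤ) * (-t γ) by ring, Int.add_mul_emod_self_left]
    simp only [e]
  calc ∑' y : Site (d + 1), (if y γ % (Lc : ℤ) = (Lc : ℤ) - 1 then (1 : ℝ) else 0) *
        vertexOfK (unitK sf sm (coDressKBmAt (toSite rb) Lc (KInvStep (d := d) Lc j))) Lc (unitS sf sm T) μ u (y + -((Lc : ℤ) • t)) y₁ (Sum.inl γ) (Sum.inl a)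
      = ∑' y : Site (d + 1), (if (y + -((Lc : ℤ) • t)) γ % (Lc : ℤ) = (Lc : ℤ) - 1 then (1 : ℝ) else 0) *
        vertexOfK (unitK sf sm (coDressKBmAt (toSite rb) Lc (KInvStep (d := d) Lc j))) Lc (unitS sf sm T) μ u (y + -((Lc : ℤ) • t)) y₁ (Sum.inl γ) (Sum.inl a) :=
          tsum_congr fun y => by rw [hf]
    _ = _ := (Equiv.addRight (-((Lc : ℤ) • t))).tsum_eq (fun y : Site (d + 1) => (if y γ % (Lc : ℤ) = (Lc : ℤ) - 1 then (1 : ℝ) else 0) *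
        vertexOfK (unitK sf sm (coDressKBmAt (toSite rb) Lc (KInvStep (d := d) Lc j))) Lc (unitS sf sm T) μ u y y₁ (Sum.inl γ) (Sum.inl a))

/-- NOT IN PRINT; OUR BOOKKEEPING ([folklore]).  **IN THE ZERO MODE THE LEFT FAMILY DOES NOT SEE THE SLOT TRANSPORT OF ITS TABLE**: for a local block-covariant `W`, any transport root `r′`, any
`Lc`-periodic bounded form `A`,
`Σ_{c ∈ box Lc} Σ'_{y₁} Σ_a j^{slotPsiS r′ Lc W}_{toSite c}(a, y₁)·A a y₁ = Σ_{c ∈ box Lc} Σ'_{y₁} Σ_a j^{W}_{toSite c}(a, y₁)·A a y₁` — both sides regroup to `|box|·Σ_{r₀ ∈ box} Σ_a (Σ'_v j_v(a, toSite r₀))·A a (toSite r₀)`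
(leaf-04's `CoarseBondCellPairing.sum_box_tsum_sum_mul_periodic_of_cov`), and `Σ'_v j^{slotPsiS W}_v = Σ'_v j^{W}_v` entrywise by §2. -/
theorem sum_box_leftFamily_slotPsiS_eq (hLc : 1 ≤ Lc) (hrb : rb ∈ box (d + 1) Lc) (sf sm : ℝ) (j : ℕ) (r' : Fin (d + 1) → ℕ)
    {W : Fin (d + 1) → Site (d + 1) → MKer (d + 1) (Fib d)} {CW δW : ℝ} (hW : LocStencil W CW δW) (hδW : 0 < δW)
    (hWt : ∀ (κ : Fin (d + 1)) (u t : Site (d + 1)), W κ (u + (Lc : ℤ) • t) = shiftK (-((Lc : ℤ) • t)) (W κ u))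
    {A : Fin (d + 1) → Site (d + 1) → ℝ} {M : ℝ} (hA : ∀ a y, |A a y| ≤ M) (hAper : ∀ (a : Fin (d + 1)) (y t : Site (d + 1)), A a (y + (Lc : ℤ) • t) = A a y) :
    ∑ c ∈ box (d + 1) Lc, ∑' y₁ : Site (d + 1), ∑ a : Fin (d + 1),
        (∑' y : Site (d + 1), (if y γ % (Lc : ℤ) = (Lc : ℤ) - 1 then (1 : ℝ) else 0) *
          vertexOfK (unitK sf sm (coDressKBmAt (toSite rb) Lc (KInvStep (d := d) Lc j))) Lc (unitS sf sm (slotPsiS r' Lc W)) μ (toSite c) y y₁ (Sum.inl γ) (Sum.inl a)) * A a y₁ =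
      ∑ c ∈ box (d + 1) Lc, ∑' y₁ : Site (d + 1), ∑ a : Fin (d + 1),
        (∑' y : Site (d + 1), (if y γ % (Lc : ℤ) = (Lc : ℤ) - 1 then (1 : ℝ) else 0) *
          vertexOfK (unitK sf sm (coDressKBmAt (toSite rb) Lc (KInvStep (d := d) Lc j))) Lc (unitS sf sm W) μ (toSite c) y y₁ (Sum.inl γ) (Sum.inl a)) * A a y₁ := by
  have hLc0 : 0 < Lc := hLc
  have hWs := locStencil_slotPsiS (d := d) hLc0 r' hW hδW.le
  have hWst : ∀ (κ : Fin (d + 1)) (u t : Site (d + 1)), slotPsiS r' Lc W κ (u + (Lc : ℤ) • t) = shiftK (-((Lc : ℤ) • t)) (slotPsiS r' Lc W κ u) :=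
    fun κ u t => slotPsiS_shift hLc0 r' hWt κ u t
  have h1 : ∀ y : Site (d + 1), |(if y γ % (Lc : ℤ) = (Lc : ℤ) - 1 then (1 : ℝ) else 0)| ≤ 1 := fun y => by split_ifs <;> simp
  rw [sum_box_tsum_sum_mul_periodic_of_cov (N := Lc)
      (j := fun (u : Site (d + 1)) (a : Fin (d + 1)) (y₁ : Site (d + 1)) => ∑' y : Site (d + 1), (if y γ % (Lc : ℤ) = (Lc : ℤ) - 1 then (1 : ℝ) else 0) *
        vertexOfK (unitK sf sm (coDressKBmAt (toSite rb) Lc (KInvStep (d := d) Lc j))) Lc (unitS sf sm (slotPsiS r' Lc W)) μ u y y₁ (Sum.inl γ) (Sum.inl a))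
      (A := A) (fun u a y₁ t => leftFamily_cov_of_block_cov (rb := rb) (μ := μ) (γ := γ) hLc sf sm j hWst u a y₁ t) hAper
      (fun u a => summable_leftFamily_mul_of_locStencil (μ := μ) (γ := γ) hLc hrb sf sm j hWs hδW (fun y => hA a y) u a),
    sum_box_tsum_sum_mul_periodic_of_cov (N := Lc)
      (j := fun (u : Site (d + 1)) (a : Fin (d + 1)) (y₁ : Site (d + 1)) => ∑' y : Site (d + 1), (if y γ % (Lc : ℤ) = (Lc : ℤ) - 1 then (1 : ℝ) else 0) *
        vertexOfK (unitK sf sm (coDressKBmAt (toSite rb) Lc (KInvStep (d := d) Lc j))) Lc (unitS sf sm W) μ u y y₁ (Sum.inl γ) (Sum.inl a))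
      (A := A) (fun u a y₁ t => leftFamily_cov_of_block_cov (rb := rb) (μ := μ) (γ := γ) hLc sf sm j hWt u a y₁ t) hAper
      (fun u a => summable_leftFamily_mul_of_locStencil (μ := μ) (γ := γ) hLc hrb sf sm j hW hδW (fun y => hA a y) u a)]
  congr 1
  refine Finset.sum_congr rfl fun r₀ _ => Finset.sum_congr rfl fun a _ => ?_
  congr 1
  exact tsum_tsum_weight_fst_vertexOfK_dressedStep_slotPsiS hLc hrb sf sm j μ r' hW hδW h1 (toSite r₀) (Sum.inl γ) (Sum.inl a)

end LeftFamily

end Summit.QuantumFields.BalabanUV.Beta.GAN24.CombBorderWordTools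

end
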